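import Mathlib
import Literature.Probability.LatticeModels.LatticeGreenFunction
import Literature.Probability.LatticeModels.TorusFourierProofs
import Literature.Probability.LatticeModels.MaxwellKernelTransverse
import HarnessLib

/-!
# The lattice Maxwell kernel on the four-torus, II: the `n⁻⁴` band

Topic `Probability/LatticeModels`, continuation of `MaxwellKernelTransverse.lean`. PROVED here:

* `torusGreen_second_difference`, `torusGreen_second_difference_axis` (any dimension `d`) —
  second lattice differences of the zero-mode-free torus Green function
  `G̃_L = torusGreen` (`LatticeGreenFunction.lean`) in Fourier form:
  `2G̃_L(z) - G̃_L(z + e_μ) - G̃_L(z - e_μ) = L^{-d} ∑_{k ≠ 0} 2(1 - cos p_{k,μ}) cos(p_k·z)/ε(p_k)`,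
  i.e. `-Δ_μ G̃_L` has multiplier `k̂_μ²/k̂²` (`2cos θ - cos(θ+p) - cos(θ-p) = 2(1 - cos p)cos θ`,
  via the characters `torusChar` of `TorusFourierProofs.lean`);
* `maxwellKernel_axis_band` — **the band**: absolute constants `0 < c ≤ C` with
  `c ≤ n⁴ L⁻⁴ ∑_{k ≠ 0} (1 - cos p_{k,μ}) cos(n p_{k,ν})/ε(p_k) ≤ C` for all `L`, `μ ≠ ν`,
  `1 ≤ n ≤ L/8`: lower bound from the infrared box `k'ᵢ ∈ [1, L/(8n)]` of the transverse sum
  (`transverse_term_ge`, all summands being nonnegative), upper bound by factorising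
  `X e^{-nX/24}` over the three transverse cycles (`transverse_term_nonneg_le`,
  `cycle_sum_exp_neg_sqrt_le`, `cycle_sum_sqrt_mul_exp_le`);
* `torusGreen_second_difference_axis_band` — the same band for
  `n⁴ (2G̃_L(ne_ν) - G̃_L(ne_ν + e_μ) - G̃_L(ne_ν - e_μ))` on `(ℤ/Lℤ)⁴`.

In words: the tree-level `F_{μν}F_{μν}` kernel of four-dimensional lattice Maxwell theory along a
lattice axis is of exact order `n⁻⁴` uniformly in the volume once `L ≥ 8n` — the lattice
counterpart of the continuum dipole–dipole decay `|x|⁻⁴` (cf. Montvay–Münster, *Quantum Fields on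
a Lattice*, §3.2; Glimm–Jaffe, *Quantum Physics*, §7 for the continuum free field). Elementary;
no single source is followed; the constants are not optimised.
Deliberately NOT here: general `d`, off-axis separations, the `L → ∞` limit of `n⁴ H_L`.
-/

noncomputable section

open Finset Real

namespace Literature.Probability.LatticeModels

variable {d L : ℕ}

/-- The phase of a unit lattice vector: `cos (∑ᵢ p_{k,i} (e_μ)ᵢ.val) = cos p_{k,μ}` (for `L = 1` both
sides are `cos 0`). [folklore] -/
theorem cos_phase_single_one [NeZero L] (k : TorusSite d L) (μ : Fin d) :
    Real.cos (∑ i, latticeMomentum L k i * (((Pi.single μ (1 : ZMod L) : TorusSite d L) i).val : ℝ)) =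
      Real.cos (latticeMomentum L k μ) := by
  rw [Finset.sum_eq_single μ (fun i _ hi => by simp [Pi.single_eq_of_ne hi])
    (fun h => absurd (mem_univ μ) h)]
  simp only [Pi.single_eq_same]
  rw [ZMod.val_one_eq_one_mod]
  rcases Nat.lt_or_ge 1 L with h | h
  · rw [Nat.mod_eq_of_lt h, Nat.cast_one, mul_one]
  · have hL1 : L = 1 := le_antisymm h (Nat.one_le_iff_ne_zero.2 (NeZero.ne L))
    have hv : (k μ).val = 0 := by
      have := ZMod.val_lt (k μ)
      omega
    have : latticeMomentum L k μ = 0 := by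
      simp [latticeMomentum, hv]
    simp [this]

/-- The phase of `n e_ν` (`n < L`): `∑ᵢ p_{k,i} (n e_ν)ᵢ.val = p_{k,ν} n`. [folklore] -/
theorem phase_single_natCast (k : TorusSite d L) (ν : Fin d) {n : ℕ} (hn : n < L) :
    ∑ i, latticeMomentum L k i * (((Pi.single ν (n : ZMod L) : TorusSite d L) i).val : ℝ) =
      latticeMomentum L k ν * n := by
  rw [Finset.sum_eq_single ν (fun i _ hi => by simp [Pi.single_eq_of_ne hi])
    (fun h => absurd (mem_univ ν) h)]
  simp only [Pi.single_eq_same, ZMod.val_natCast_of_lt hn]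

/-- **Second lattice differences of the torus Green function in Fourier form**: for
`z ∈ (ℤ/Lℤ)^d` and a direction `μ`,
`2 G̃_L(z) - G̃_L(z + e_μ) - G̃_L(z - e_μ) = L^{-d} ∑_{k ≠ 0} 2(1 - cos p_{k,μ}) cos(p_k·z) / ε(p_k)`
(`2cos θ - cos(θ + p_μ) - cos(θ - p_μ) = 2(1 - cos p_μ) cos θ`). In words: `-Δ_μ G̃_L` has Fourier
multiplier `k̂_μ² / k̂²` off the zero mode. [folklore] -/
theorem torusGreen_second_difference [NeZero L] (z : TorusSite d L) (μ : Fin d) :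
    2 * torusGreen z - torusGreen (z + Pi.single μ 1) - torusGreen (z - Pi.single μ 1) =
      (∑ k ∈ (univ : Finset (TorusSite d L)).erase 0,
        2 * (1 - Real.cos (latticeMomentum L k μ)) *
          Real.cos (∑ i, latticeMomentum L k i * ((z i).val : ℝ)) /
            dispersion (latticeMomentum L k)) / ((L : ℝ) ^ d) := by
  unfold torusGreen
  rw [mul_div_assoc', ← sub_div, ← sub_div, Finset.mul_sum, ← Finset.sum_sub_distrib,
    ← Finset.sum_sub_distrib]
  congr 1
  refine Finset.sum_congr rfl fun k _ => ?_
  have key : Real.cos (∑ i, latticeMomentum L k i * (((z + Pi.single μ 1 : TorusSite d L) i).val : ℝ)) +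
      Real.cos (∑ i, latticeMomentum L k i * (((z - Pi.single μ 1 : TorusSite d L) i).val : ℝ)) =
      2 * Real.cos (latticeMomentum L k μ) *
        Real.cos (∑ i, latticeMomentum L k i * ((z i).val : ℝ)) := by
    rw [← torusChar_re, ← torusChar_re, ← torusChar_re, torusChar_add_right, torusChar_sub_right,
      ← cos_phase_single_one k μ, ← torusChar_re]
    simp only [Complex.mul_re, Complex.conj_re, Complex.conj_im]
    ring
  have e : ∀ A B C E : ℝ, 2 * (A / E) - B / E - C / E = (2 * A - (B + C)) / E := fun A B C E => by ring
  rw [e, key]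
  ring

/-- **Second differences of the torus Green function along an axis**: for `n < L`, directions
`μ, ν` and `z = n e_ν`,
`2 G̃_L(n e_ν) - G̃_L(n e_ν + e_μ) - G̃_L(n e_ν - e_μ) = L^{-d} ∑_{k ≠ 0} 2(1 - cos p_{k,μ}) cos(n p_{k,ν}) / ε(p_k)`.
[folklore] -/
theorem torusGreen_second_difference_axis [NeZero L] (μ ν : Fin d) {n : ℕ} (hn : n < L) :
    2 * torusGreen (Pi.single ν (n : ZMod L) : TorusSite d L) -
        torusGreen ((Pi.single ν (n : ZMod L) : TorusSite d L) + Pi.single μ 1) -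
        torusGreen ((Pi.single ν (n : ZMod L) : TorusSite d L) - Pi.single μ 1) =
      (∑ k ∈ (univ : Finset (TorusSite d L)).erase 0,
        2 * (1 - Real.cos (latticeMomentum L k μ)) * Real.cos (latticeMomentum L k ν * n) /
          dispersion (latticeMomentum L k)) / ((L : ℝ) ^ d) := by
  rw [torusGreen_second_difference]
  simp_rw [phase_single_natCast _ ν hn]

section Band

/-- **The lattice Maxwell kernel band on the four-torus.** There are absolute constants
`0 < c ≤ C` such that for all `L`, directions `μ ≠ ν`, and `1 ≤ n ≤ L/8`,
`c ≤ n⁴ · L⁻⁴ ∑_{k ≠ 0} (1 - cos p_{k,μ}) cos(n p_{k,ν}) / ε(p_k) ≤ C`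
(`p_k = 2πk/L`, `ε(p) = ∑ᵢ (1 - cos pᵢ)`): the mixed second difference `-∂_μ² G̃_L(n e_ν)` of the
torus Green function — one half of the tree-level plaquette–plaquette (`F_{μν}F_{μν}`) kernel of
lattice Maxwell theory — is of exact order `n⁻⁴`, uniformly in the volume. Proof: transverse
reduction to cycle resolvents (`sum_erase_zero_eq_sum_transverse`), which are positive; the lower
bound keeps the infrared box `k'ᵢ ∈ [1, L/(8n)]` (`transverse_term_ge`), the upper bound
factorises `X e^{-nX/24}` over the three transverse cycles (`transverse_term_nonneg_le`,
`cycle_sum_exp_neg_sqrt_le`, `cycle_sum_sqrt_mul_exp_le`). [folklore] -/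
theorem maxwellKernel_axis_band :
    ∃ c C : ℝ, 0 < c ∧ ∀ (L : ℕ) [NeZero L] (μ ν : Fin 4), μ ≠ ν → ∀ n : ℕ, 1 ≤ n → 8 * n ≤ L →
      c ≤ (n : ℝ) ^ 4 * ((∑ k ∈ (univ : Finset (TorusSite 4 L)).erase 0,
          (1 - Real.cos (latticeMomentum L k μ)) * Real.cos (latticeMomentum L k ν * n) /
            dispersion (latticeMomentum L k)) / (L : ℝ) ^ 4) ∧
      (n : ℝ) ^ 4 * ((∑ k ∈ (univ : Finset (TorusSite 4 L)).erase 0,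
          (1 - Real.cos (latticeMomentum L k μ)) * Real.cos (latticeMomentum L k ν * n) /
            dispersion (latticeMomentum L k)) / (L : ℝ) ^ 4) ≤ C := by
  refine ⟨4 * Real.exp (-3) / (3 * 16 ^ 5), 5 / 2 * (3 * (2400 * 26 ^ 2)), by positivity, ?_⟩
  intro L _ μ ν hμν n hn h8
  obtain ⟨μ', rfl⟩ := Fin.exists_succAbove_eq hμν
  have hL0 : (0 : ℝ) < L := by exact_mod_cast Nat.pos_of_ne_zero (NeZero.ne L)
  have hLne : (L : ℝ) ≠ 0 := hL0.ne'
  have hn0 : (0 : ℝ) < n := by exact_mod_cast hn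
  have hnne : (n : ℝ) ≠ 0 := hn0.ne'
  have hLn : (n : ℝ) ≤ L := by exact_mod_cast (show n ≤ L by omega)
  have h2n : 2 * n ≤ L := by omega
  rw [sum_erase_zero_eq_sum_transverse ν μ' n]
  set T : TorusSite 3 L → ℝ := fun k' => (1 - Real.cos (latticeMomentum L k' μ')) *
    ∑ j : ZMod L, Real.cos (2 * π * (j.val : ℝ) / L * n) /
      ((1 + dispersion (latticeMomentum L k')) - Real.cos (2 * π * (j.val : ℝ) / L)) with hT
  -- one-dimensional sums
  set x : ZMod L → ℝ := fun y => Real.sqrt (1 - Real.cos (2 * π * (y.val : ℝ) / L)) with hx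
  set S₀ : ℝ := ∑ y : ZMod L, Real.exp (-(n / 24 * x y)) with hS₀
  set S₁ : ℝ := ∑ y : ZMod L, x y * Real.exp (-(n / 24 * x y)) with hS₁
  have hS₀le : S₀ ≤ 26 * L / n := by
    have h := cycle_sum_exp_neg_sqrt_le (L := L) (β := n / 24) (by positivity)
    have e : (L : ℝ) / (n / 24) = 24 * L / n := by field_simp
    rw [e] at h
    have h2 : (2 : ℝ) ≤ 2 * L / n := by
      rw [le_div_iff₀ hn0]
      linarith only [hLn]
    calc S₀ ≤ 2 + 24 * L / n := h
      _ ≤ 26 * L / n := by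
          have h3 : (2 : ℝ) + 24 * L / n ≤ 2 * L / n + 24 * L / n := by linarith only [h2]
          refine h3.trans (le_of_eq ?_)
          ring
  have hS₁le : S₁ ≤ 2400 * L / n ^ 2 := by
    have h := cycle_sum_sqrt_mul_exp_le (L := L) (β := n / 24) (by positivity)
    have h2 : (2 : ℝ) ≤ 2 * L / n := by
      rw [le_div_iff₀ hn0]
      linarith only [hLn]
    calc S₁ ≤ 2 / (n / 24) * (2 + 2 * L / (n / 24)) := h
      _ = 48 / n * (2 + 48 * L / n) := by field_simp; ring
      _ ≤ 48 / n * (2 * L / n + 48 * L / n) := by gcongr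
      _ = 2400 * L / n ^ 2 := by field_simp; ring
  have hS₀0 : 0 ≤ S₀ := sum_nonneg fun _ _ => Real.exp_nonneg _
  have hS₁0 : 0 ≤ S₁ := sum_nonneg fun _ _ => mul_nonneg (Real.sqrt_nonneg _) (Real.exp_nonneg _)
  constructor
  · -- the lower bound: restrict to the infrared box
    set M : ℕ := L / (8 * n) with hM
    have hM1 : 1 ≤ M := Nat.div_pos h8 (by omega)
    have hM8 : 8 * n * M ≤ L := by
      have h1 := Nat.div_mul_le_self L (8 * n)
      rw [← hM] at h1
      calc 8 * n * M = M * (8 * n) := by ring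
        _ ≤ L := h1
    have hML : (L : ℝ) < 16 * n * M := by
      have h1 : L < L / (8 * n) * (8 * n) + 8 * n := Nat.lt_div_mul_add (by omega)
      rw [← hM] at h1
      have h2 : (L : ℝ) < M * (8 * n) + 8 * n := by exact_mod_cast h1
      have h3 : (1 : ℝ) ≤ M := by exact_mod_cast hM1
      nlinarith only [h2, h3, hn0]
    have hMltL : M < L := by
      have h2 : M ≤ L / 8 := by
        rw [hM]
        exact Nat.div_le_div_left (by omega) (by norm_num)
      omega
    set SM : Finset (ZMod L) := (range M).image (fun v : ℕ => ((v + 1 : ℕ) : ZMod L)) with hSM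
    have hinj : Set.InjOn (fun v : ℕ => ((v + 1 : ℕ) : ZMod L)) (range M : Finset ℕ) := by
      intro v hv w hw h
      have hv' := mem_range.1 (Finset.mem_coe.1 hv)
      have hw' := mem_range.1 (Finset.mem_coe.1 hw)
      have h' := congrArg ZMod.val h
      simp only [ZMod.val_natCast_of_lt (show v + 1 < L by omega),
        ZMod.val_natCast_of_lt (show w + 1 < L by omega)] at h'
      omega
    have hcardSM : (#SM : ℝ) = M := by
      rw [hSM, card_image_of_injOn hinj, card_range]
    have hsumSM : ∑ y ∈ SM, ((y.val : ℝ)) ^ 2 = ∑ v ∈ range M, ((v : ℝ) + 1) ^ 2 := by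
      rw [hSM, sum_image hinj]
      refine sum_congr rfl fun v hv => ?_
      have hv' := mem_range.1 hv
      rw [ZMod.val_natCast_of_lt (show v + 1 < L by omega)]
      push_cast
      ring
    set B : Finset (TorusSite 3 L) := Fintype.piFinset (fun _ : Fin 3 => SM) with hB
    have hBox : ∀ k' ∈ B, ∀ i, 1 ≤ (k' i).val ∧ (k' i).val ≤ M := by
      intro k' hk' i
      have h := Fintype.mem_piFinset.1 hk' i
      rw [hSM, mem_image] at h
      obtain ⟨v, hv, hv'⟩ := h
      have hv'' := mem_range.1 hv
      rw [← hv', ZMod.val_natCast_of_lt (show v + 1 < L by omega)]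
      omega
    have hTnn : ∀ k', 0 ≤ T k' := fun k' => (transverse_term_nonneg_le k' μ' h2n).1
    -- the box sum of the squares of the `μ'` components
    have hboxsum : ∑ k' ∈ B, ((k' μ').val : ℝ) ^ 2 = (∑ v ∈ range M, ((v : ℝ) + 1) ^ 2) * M ^ 2 := by
      have e1 : ∀ k' : TorusSite 3 L, ((k' μ').val : ℝ) ^ 2 =
          ∏ i, (if i = μ' then ((k' i).val : ℝ) ^ 2 else 1) := fun k' => by
        rw [Finset.prod_ite_eq']
        simp
      simp_rw [e1]
      rw [hB, ← Finset.prod_univ_sum (fun _ : Fin 3 => SM) (fun i y => if i = μ' then ((y.val : ℝ)) ^ 2 else 1)]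
      have e2 : ∀ i : Fin 3, ∑ y ∈ SM, (if i = μ' then ((y.val : ℝ)) ^ 2 else 1) =
          if i = μ' then ∑ v ∈ range M, ((v : ℝ) + 1) ^ 2 else (M : ℝ) := by
        intro i
        split_ifs
        · exact hsumSM
        · rw [sum_const, nsmul_eq_mul, mul_one, hcardSM]
      simp_rw [e2]
      exact prod_ite_eq_fin_three μ' _ _
    have hcube := cube_le_three_mul_sum_sq M
    calc 4 * Real.exp (-3) / (3 * 16 ^ 5)
        = (4 * Real.exp (-3) / 3) * ((L : ℝ) / (16 * n)) ^ 5 * (n : ℝ) ^ 5 / (L : ℝ) ^ 5 := by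
          field_simp
      _ ≤ (4 * Real.exp (-3) / 3) * (M : ℝ) ^ 5 * (n : ℝ) ^ 5 / (L : ℝ) ^ 5 := by
          gcongr
          rw [div_le_iff₀ (by positivity)]
          linarith only [hML]
      _ = (n : ℝ) ^ 4 * ((4 * Real.exp (-3) * n / L * ((M : ℝ) ^ 3 / 3 * M ^ 2)) / (L : ℝ) ^ 4) := by
          field_simp
      _ ≤ (n : ℝ) ^ 4 * ((4 * Real.exp (-3) * n / L *
            ((∑ v ∈ range M, ((v : ℝ) + 1) ^ 2) * M ^ 2)) / (L : ℝ) ^ 4) := by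
          gcongr
          linarith only [hcube]
      _ = (n : ℝ) ^ 4 * ((∑ k' ∈ B, 4 * Real.exp (-3) * n * ((k' μ').val : ℝ) ^ 2 / L) /
            (L : ℝ) ^ 4) := by
          rw [← hboxsum, mul_sum]
          congr 2
          refine sum_congr rfl fun k' _ => ?_
          ring
      _ ≤ (n : ℝ) ^ 4 * ((∑ k' ∈ B, T k') / (L : ℝ) ^ 4) := by
          gcongr with k' hk'
          exact transverse_term_ge k' μ' hn hM8 (hBox k' hk')
      _ ≤ (n : ℝ) ^ 4 * ((∑ k', T k') / (L : ℝ) ^ 4) :=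
          mul_le_mul_of_nonneg_left (div_le_div_of_nonneg_right
            (sum_le_sum_of_subset_of_nonneg (subset_univ B) (fun k' _ _ => hTnn k'))
            (by positivity)) (by positivity)
  · -- the upper bound: factorise over the transverse cycles
    have hTle : ∀ k', T k' ≤ 5 / 2 * L * ((∑ i, x (k' i)) * Real.exp (-(n / 24 * ∑ i, x (k' i)))) :=
      fun k' => (transverse_term_nonneg_le k' μ' h2n).2
    have hfac : ∑ k' : TorusSite 3 L, (∑ i, x (k' i)) * Real.exp (-(n / 24 * ∑ i, x (k' i))) =
        ∑ i : Fin 3, ∏ j : Fin 3, (if j = i then S₁ else S₀) := by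
      have e1 : ∀ k' : TorusSite 3 L, (∑ i, x (k' i)) * Real.exp (-(n / 24 * ∑ i, x (k' i))) =
          ∑ i, ∏ j, ((if j = i then x (k' j) else 1) * Real.exp (-(n / 24 * x (k' j)))) := by
        intro k'
        rw [mul_sum, ← sum_neg_distrib, Real.exp_sum, sum_mul]
        refine sum_congr rfl fun i _ => ?_
        rw [prod_mul_distrib, Finset.prod_ite_eq']
        simp
      simp_rw [e1]
      rw [sum_comm]
      refine sum_congr rfl fun i _ => ?_
      rw [← Fintype.piFinset_univ, ← Finset.prod_univ_sum (fun _ : Fin 3 => (univ : Finset (ZMod L)))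
        (fun j y => (if j = i then x y else 1) * Real.exp (-(n / 24 * x y)))]
      refine prod_congr rfl fun j _ => ?_
      by_cases h : j = i <;> simp [h, hS₀, hS₁]
    calc (n : ℝ) ^ 4 * ((∑ k', T k') / (L : ℝ) ^ 4)
        ≤ (n : ℝ) ^ 4 * ((∑ k' : TorusSite 3 L, 5 / 2 * L *
            ((∑ i, x (k' i)) * Real.exp (-(n / 24 * ∑ i, x (k' i))))) / (L : ℝ) ^ 4) := by
          gcongr with k' _
          exact hTle k'
      _ = (n : ℝ) ^ 4 * (5 / 2 * L * (3 * (S₁ * S₀ ^ 2)) / (L : ℝ) ^ 4) := by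
          rw [← mul_sum, hfac]
          simp_rw [prod_ite_eq_fin_three]
          simp
      _ ≤ (n : ℝ) ^ 4 * (5 / 2 * L * (3 * ((2400 * L / n ^ 2) * (26 * L / n) ^ 2)) / (L : ℝ) ^ 4) := by
          gcongr
      _ = 5 / 2 * (3 * (2400 * 26 ^ 2)) := by
          field_simp

/-- **Axis second differences of the four-torus Green function are of order `n⁻⁴`.** There are
absolute constants `0 < c ≤ C` with
`c ≤ n⁴ (2 G̃_L(n e_ν) - G̃_L(n e_ν + e_μ) - G̃_L(n e_ν - e_μ)) ≤ C`
for all `L`, `μ ≠ ν`, `1 ≤ n ≤ L/8` (`G̃_L = torusGreen`, the zero-mode-free Green function of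
`ε(p) = ∑ᵢ(1 - cos pᵢ)` on `(ℤ/Lℤ)⁴`): `torusGreen_second_difference_axis` and
`maxwellKernel_axis_band`. This is the volume-uniform two-sided bound on the tree-level
`⟨F_{μν}(0) F_{μν}(n e_ν)⟩` kernel of four-dimensional lattice Maxwell theory along a lattice
axis. [folklore] -/
theorem torusGreen_second_difference_axis_band :
    ∃ c C : ℝ, 0 < c ∧ ∀ (L : ℕ) [NeZero L] (μ ν : Fin 4), μ ≠ ν → ∀ n : ℕ, 1 ≤ n → 8 * n ≤ L →
      c ≤ (n : ℝ) ^ 4 * (2 * torusGreen (Pi.single ν (n : ZMod L) : TorusSite 4 L) -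
          torusGreen ((Pi.single ν (n : ZMod L) : TorusSite 4 L) + Pi.single μ 1) -
          torusGreen ((Pi.single ν (n : ZMod L) : TorusSite 4 L) - Pi.single μ 1)) ∧
      (n : ℝ) ^ 4 * (2 * torusGreen (Pi.single ν (n : ZMod L) : TorusSite 4 L) -
          torusGreen ((Pi.single ν (n : ZMod L) : TorusSite 4 L) + Pi.single μ 1) -
          torusGreen ((Pi.single ν (n : ZMod L) : TorusSite 4 L) - Pi.single μ 1)) ≤ C := by
  obtain ⟨c, C, hc, h⟩ := maxwellKernel_axis_band
  refine ⟨2 * c, 2 * C, by positivity, ?_⟩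
  intro L _ μ ν hμν n hn h8
  rw [torusGreen_second_difference_axis μ ν (by omega : n < L)]
  have key : (∑ k ∈ (univ : Finset (TorusSite 4 L)).erase 0,
      2 * (1 - Real.cos (latticeMomentum L k μ)) * Real.cos (latticeMomentum L k ν * n) /
        dispersion (latticeMomentum L k)) / ((L : ℝ) ^ 4) =
      2 * ((∑ k ∈ (univ : Finset (TorusSite 4 L)).erase 0,
        (1 - Real.cos (latticeMomentum L k μ)) * Real.cos (latticeMomentum L k ν * n) /
          dispersion (latticeMomentum L k)) / (L : ℝ) ^ 4) := by
    rw [mul_div_assoc', Finset.mul_sum]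
    congr 1
    refine Finset.sum_congr rfl fun k _ => ?_
    ring
  rw [key]
  obtain ⟨h1, h2⟩ := h L μ ν hμν n hn h8
  constructor
  · linarith
  · linarith

end Band

end Literature.Probability.LatticeModels

end

/-! ### The full plaquette kernel along an axis -/

namespace Literature.Probability.LatticeModels

/-- **The tree-level plaquette–plaquette kernel along a lattice axis is of order `n⁻⁴`.** For
directions `μ ≠ ν`, `κ ≠ ν` of `(ℤ/Lℤ)⁴` and `1 ≤ n ≤ L/8`, the `F_{μκ}F_{μκ}` kernel of lattice
Maxwell theory at separation `n e_ν`,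
`K_L(n e_ν) = ½ ∑_{ρ ∈ {μ, κ}} (2G̃_L(ne_ν) - G̃_L(ne_ν + e_ρ) - G̃_L(ne_ν - e_ρ))`
(`= L⁻⁴ ∑_{k ≠ 0} (k̂_μ² + k̂_κ²) cos(n p_{k,ν}) / (2 k̂²)·2`, i.e. the multiplier `(k̂_μ² + k̂_κ²)/k̂²`
halved per direction), satisfies `c ≤ n⁴ K_L(n e_ν) ≤ C` with the absolute constants of
`torusGreen_second_difference_axis_band` (average of the two axis second differences). [folklore] -/
theorem torusGreen_plaquetteKernel_axis_band :
    ∃ c C : ℝ, 0 < c ∧ ∀ (L : ℕ) [NeZero L] (μ κ ν : Fin 4), μ ≠ ν → κ ≠ ν →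
      ∀ n : ℕ, 1 ≤ n → 8 * n ≤ L →
      c ≤ (n : ℝ) ^ 4 * (((2 * torusGreen (Pi.single ν (n : ZMod L) : TorusSite 4 L) -
          torusGreen ((Pi.single ν (n : ZMod L) : TorusSite 4 L) + Pi.single μ 1) -
          torusGreen ((Pi.single ν (n : ZMod L) : TorusSite 4 L) - Pi.single μ 1)) +
        (2 * torusGreen (Pi.single ν (n : ZMod L) : TorusSite 4 L) -
          torusGreen ((Pi.single ν (n : ZMod L) : TorusSite 4 L) + Pi.single κ 1) -
          torusGreen ((Pi.single ν (n : ZMod L) : TorusSite 4 L) - Pi.single κ 1))) / 2) ∧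
      (n : ℝ) ^ 4 * (((2 * torusGreen (Pi.single ν (n : ZMod L) : TorusSite 4 L) -
          torusGreen ((Pi.single ν (n : ZMod L) : TorusSite 4 L) + Pi.single μ 1) -
          torusGreen ((Pi.single ν (n : ZMod L) : TorusSite 4 L) - Pi.single μ 1)) +
        (2 * torusGreen (Pi.single ν (n : ZMod L) : TorusSite 4 L) -
          torusGreen ((Pi.single ν (n : ZMod L) : TorusSite 4 L) + Pi.single κ 1) -
          torusGreen ((Pi.single ν (n : ZMod L) : TorusSite 4 L) - Pi.single κ 1))) / 2) ≤ C := by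
  obtain ⟨c, C, hc, h⟩ := torusGreen_second_difference_axis_band
  refine ⟨c, C, hc, ?_⟩
  intro L _ μ κ ν hμ hκ n hn h8
  obtain ⟨h1, h2⟩ := h L μ ν hμ n hn h8
  obtain ⟨h3, h4⟩ := h L κ ν hκ n hn h8
  constructor
  · linarith
  · linarith

end Literature.Probability.LatticeModels
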